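import Summits.ResolutionOfSingularities.ResolutionOfSingularities.Theorems.RadicialJungCleanModelsSufficeGameEndCharge

/-!
# Route `RadicialJung`, crux `CleanModelsSuffice`, line `Sketch`: the END STATE of the game —
# generic points of codimension-two strata and the good neighbourhood of a point

Helper for the registered stub `stub_gameEndResolves` of the skeleton of
`Summit.ResolutionOfSingularities.ResolutionOfSingularities.Theses.RadicialJung.CleanModelsSuffice`
(stmt-ResolutionOfSingularities-15883). For a game state `S` and a point `v`, two exceptional
divisors `D₀ ≠ D` through `v` have distinct label coordinates `u_{ℓ₀}, u_ℓ`, the prime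
`(u_{ℓ₀}, u_ℓ) ⊆ 𝒪_{V,v}` defines the generic point `genPt₂` of the branch of `D₀ ∩ D` at `v`, and:

* `primeOfSpecializes_genPt₂_eq` — at a second point `w ∈ D₀ ∩ D` under it, its prime is again
  the pair of label coordinates of `D₀, D` at `w`;
* `isRsopPart_genPt₂` — the images of `u_{ℓ₀}, u_ℓ` in `𝒪_{V,genPt₂}` are part of a regular system
  of parameters (`IsRsopPart.map_of_le_prime`);
* `GameState.Near S v w` — **the good-neighbourhood relation**: the exceptional divisors through
  `w` pass through `v`, and `w` lies under the generic points of the branches at `v` of every such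
  divisor and of every pair of them; `exists_nhds_near` — it holds on an open neighbourhood of `v`
  (`StalkIdealGenerization.lean`), and then charges at `w` are charges at `v`
  (`Near.chargedAt_iff`).
-/

noncomputable section

set_option linter.dupNamespace false -- mandated namespace of this single-conjunct summit

open CategoryTheory AlgebraicGeometry TopologicalSpace IsLocalRing
open Literature.AlgebraicGeometry.Resolution

namespace Summit.ResolutionOfSingularities.ResolutionOfSingularities.Theorems.RadicialJung.CleanModelsSuffice

namespace GameState

variable {p : ℕ} {V₀ : Scheme.{0}} [IsIntegral V₀] {L : Type} [Field L] [Algebra V₀.functionField L]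
  {V : Scheme.{0}} [IsIntegral V] {π : V ⟶ V₀} [IsDominant π] (S : GameState p V₀ L V π)

/-! ## Pairs of coordinates -/

/-- Two distinct coordinates are part of a regular system of parameters. [folklore] -/
theorem isRsopPart_pair (v : V) {i j : Fin (S.d v)} (hij : i ≠ j) : IsRsopPart ![S.u v i, S.u v j] := by
  have h := (RoundOff.isRsopPart_u S v).comp ![i, j] (by
    intro a b hab
    fin_cases a <;> fin_cases b
    · rfl
    · exact absurd hab hij
    · exact absurd hab.symm hij
    · rfl)
  have heq : S.u v ∘ ![i, j] = ![S.u v i, S.u v j] := by ext k; fin_cases k <;> rfl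
  rwa [heq] at h

/-- `range (a, b) = {a, b}`. [folklore] -/
theorem range_pair {α : Type*} (a b : α) : Set.range ![a, b] = {a, b} := by
  ext x
  simp only [Set.mem_range, Set.mem_insert_iff, Set.mem_singleton_iff]
  constructor
  · rintro ⟨k, rfl⟩
    fin_cases k <;> simp
  · rintro (rfl | rfl)
    · exact ⟨0, rfl⟩
    · exact ⟨1, rfl⟩

/-- `(a, b) = (a) + (b)`. [folklore] -/
theorem span_range_pair {R : Type*} [CommRing R] (a b : R) :
    Ideal.span (Set.range ![a, b]) = Ideal.span {a} ⊔ Ideal.span {b} := by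
  rw [range_pair, Ideal.span_insert]

/-- The prime `(u_i, u_j)` of `𝒪_{V,v}` for `i ≠ j`. [folklore] -/
def qOf₂ (S : GameState p V₀ L V π) (v : V) {i j : Fin (S.d v)} (hij : i ≠ j) :
    PrimeSpectrum (V.presheaf.stalk v) :=
  ⟨Ideal.span (Set.range ![S.u v i, S.u v j]), (S.isRsopPart_pair v hij).isPrime_span_range⟩

/-- The generic point of the branch `u_i = u_j = 0` at `v`. [folklore] -/
def genPt₂ (S : GameState p V₀ L V π) (v : V) {i j : Fin (S.d v)} (hij : i ≠ j) : V :=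
  V.fromSpecStalk v (S.qOf₂ v hij)

/-- It specialises to `v`. [folklore] -/
theorem genPt₂_specializes (v : V) {i j : Fin (S.d v)} (hij : i ≠ j) : S.genPt₂ v hij ⤳ v :=
  fromSpecStalk_specializes _

/-- Its prime in `𝒪_{V,v}` is `(u_i, u_j)`. [folklore] -/
theorem primeOfSpecializes_genPt₂ (v : V) {i j : Fin (S.d v)} (hij : i ≠ j) :
    primeOfSpecializes (S.genPt₂_specializes v hij) = Ideal.span (Set.range ![S.u v i, S.u v j]) :=
  primeOfSpecializes_fromSpecStalk (S.qOf₂ v hij)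

/-- `𝒪_{V,genPt₂}` is the localisation of `𝒪_{V,v}` at `(u_i, u_j)`. [folklore] -/
theorem isLocalizationAtPrime_genPt₂ (v : V) {i j : Fin (S.d v)} (hij : i ≠ j) :
    letI := (V.presheaf.stalkSpecializes (S.genPt₂_specializes v hij)).hom.toAlgebra
    IsLocalization.AtPrime (V.presheaf.stalk (S.genPt₂ v hij)) (S.qOf₂ v hij).asIdeal :=
  isLocalizationAtPrime_stalk_fromSpecStalk (S.qOf₂ v hij)

/-- **The images of `u_i, u_j` in `𝒪_{V,genPt₂}` are part of a regular system of parameters.**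
[folklore] -/
theorem isRsopPart_genPt₂ (v : V) {i j : Fin (S.d v)} (hij : i ≠ j) :
    IsRsopPart fun k => (V.presheaf.stalkSpecializes (S.genPt₂_specializes v hij)).hom
      (![S.u v i, S.u v j] k) := by
  haveI := S.isRegular (S.genPt₂ v hij)
  letI := (V.presheaf.stalkSpecializes (S.genPt₂_specializes v hij)).hom.toAlgebra
  haveI := S.isLocalizationAtPrime_genPt₂ v hij
  exact (S.isRsopPart_pair v hij).map_of_le_prime (S.qOf₂ v hij).asIdeal
    (fun k => Ideal.subset_span ⟨k, rfl⟩) (V.presheaf.stalk (S.genPt₂ v hij))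

/-- Distinct divisors through `v` have distinct labels. [folklore] -/
theorem lab_ne {v : V} {D₀ D : {D : V.IdealSheafData // D ∈ S.E ∧ v ∈ D.support}} (hne : D₀.1 ≠ D.1) :
    S.lab v D₀ ≠ S.lab v D := fun h =>
  hne (congrArg Subtype.val (S.lab_injective v h))

/-- **At a second point `w ∈ D₀ ∩ D` under the generic point of the branch of `D₀ ∩ D` at `v`, the
prime of the generic point is the pair of label coordinates of `D₀, D` at `w`.** [folklore] -/
theorem primeOfSpecializes_genPt₂_eq {v w : V} (D₀ D : V.IdealSheafData)
    (hD₀v : D₀ ∈ S.E ∧ v ∈ D₀.support) (hDv : D ∈ S.E ∧ v ∈ D.support)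
    (hD₀w : D₀ ∈ S.E ∧ w ∈ D₀.support) (hDw : D ∈ S.E ∧ w ∈ D.support) (hne : D₀ ≠ D)
    (hw : S.genPt₂ v (S.lab_ne (D₀ := ⟨D₀, hD₀v⟩) (D := ⟨D, hDv⟩) hne) ⤳ w) :
    primeOfSpecializes hw =
      Ideal.span (Set.range ![S.u w (S.lab w ⟨D₀, hD₀w⟩), S.u w (S.lab w ⟨D, hDw⟩)]) := by
  haveI : (Ideal.span (Set.range ![S.u w (S.lab w ⟨D₀, hD₀w⟩), S.u w (S.lab w ⟨D, hDw⟩)])).IsPrime :=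
    (S.qOf₂ w (S.lab_ne (D₀ := ⟨D₀, hD₀w⟩) (D := ⟨D, hDw⟩) hne)).2
  refine primeOfSpecializes_eq_of_map_eq (S.genPt₂_specializes v _) hw _ ?_
  rw [S.primeOfSpecializes_genPt₂, span_range_pair, span_range_pair, Ideal.map_sup, Ideal.map_sup,
    ← S.stalkIdeal_lab w ⟨D₀, hD₀w⟩, ← S.stalkIdeal_lab w ⟨D, hDw⟩, ← S.stalkIdeal_lab v ⟨D₀, hD₀v⟩,
    ← S.stalkIdeal_lab v ⟨D, hDv⟩, stalkIdeal_map_stalkSpecializes, stalkIdeal_map_stalkSpecializes,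
    stalkIdeal_map_stalkSpecializes, stalkIdeal_map_stalkSpecializes]

/-! ## The good neighbourhood of a point -/

/-- **The good-neighbourhood relation `S.Near v w`**: the exceptional divisors through `w` pass
through `v`, and `w` lies under the generic points of the branches at `v` of each such divisor and
of each pair of them. [folklore] -/
def Near (S : GameState p V₀ L V π) (v w : V) : Prop :=
  (∀ D ∈ S.E, w ∈ D.support → v ∈ D.support) ∧
  (∀ (D : V.IdealSheafData) (hD : D ∈ S.E ∧ v ∈ D.support), w ∈ D.support →
    S.genPt v (S.lab v ⟨D, hD⟩) ⤳ w) ∧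
  (∀ (D₀ D : V.IdealSheafData) (hD₀ : D₀ ∈ S.E ∧ v ∈ D₀.support) (hD : D ∈ S.E ∧ v ∈ D.support)
    (hne : D₀ ≠ D), w ∈ D₀.support → w ∈ D.support →
    S.genPt₂ v (S.lab_ne (D₀ := ⟨D₀, hD₀⟩) (D := ⟨D, hD⟩) hne) ⤳ w)

/-- Every point has a neighbourhood on which each pair of exceptional divisors through it is the
closure of the generic point of the branch of their intersection. [folklore] -/
theorem exists_nhds_forall_genPt₂_specializes (hN : IsLocallyNoetherian V) (v : V) :
    ∃ U : V.Opens, v ∈ U ∧ ∀ w ∈ U, ∀ (D₀ D : V.IdealSheafData) (hD₀ : D₀ ∈ S.E ∧ v ∈ D₀.support)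
      (hD : D ∈ S.E ∧ v ∈ D.support) (hne : D₀ ≠ D), w ∈ D₀.support → w ∈ D.support →
      S.genPt₂ v (S.lab_ne (D₀ := ⟨D₀, hD₀⟩) (D := ⟨D, hD⟩) hne) ⤳ w := by
  classical
  set T := {D : V.IdealSheafData // D ∈ S.E ∧ v ∈ D.support}
  have hU : ∀ P : {P : T × T // P.1.1 ≠ P.2.1}, ∃ U : V.Opens, v ∈ U ∧
      ∀ w ∈ U, w ∈ P.1.1.1.support → w ∈ P.1.2.1.support →
        S.genPt₂ v (S.lab_ne (D₀ := P.1.1) (D := P.1.2) P.2) ⤳ w := by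
    intro P
    obtain ⟨U, hvU, hU⟩ := exists_nhds_mem_support_inter_iff_specializes v P.1.1.1 P.1.2.1
      (S.qOf₂ v (S.lab_ne (D₀ := P.1.1) (D := P.1.2) P.2)) (by
        change _ = Ideal.span (Set.range ![_, _])
        rw [span_range_pair, S.stalkIdeal_lab v P.1.1, S.stalkIdeal_lab v P.1.2])
    exact ⟨U, hvU, fun w hw h₁ h₂ => (hU w hw).mp ⟨h₁, h₂⟩⟩
  choose U hvU hU using hU
  haveI : Finite T := Set.Finite.to_subtype ((List.finite_toSet S.E).subset fun D hD => hD.1)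
  haveI : Finite {P : T × T // P.1.1 ≠ P.2.1} := Subtype.finite
  refine ⟨⟨⋂ P, (U P : Set V), isOpen_iInter_of_finite fun P => (U P).isOpen⟩, ?_,
    fun w hw D₀ D hD₀ hD hne h₀ h => ?_⟩
  · change v ∈ ⋂ P, (U P : Set V)
    exact Set.mem_iInter.mpr fun P => hvU P
  · have hw' : w ∈ ⋂ P, (U P : Set V) := hw
    exact hU ⟨(⟨D₀, hD₀⟩, ⟨D, hD⟩), hne⟩ w (Set.mem_iInter.mp hw' _) h₀ h

/-- **The good neighbourhood exists**: `S.Near v w` for all `w` in an open neighbourhood of `v`.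
[folklore] -/
theorem exists_nhds_near (hN : IsLocallyNoetherian V) (v : V) :
    ∃ U : V.Opens, v ∈ U ∧ ∀ w ∈ U, S.Near v w := by
  obtain ⟨U₁, hv₁, hU₁⟩ := S.exists_nhds_forall_mem_support v
  obtain ⟨U₂, hv₂, hU₂⟩ := S.exists_nhds_forall_genPt_specializes hN v
  obtain ⟨U₃, hv₃, hU₃⟩ := S.exists_nhds_forall_genPt₂_specializes hN v
  exact ⟨U₁ ⊓ U₂ ⊓ U₃, ⟨⟨hv₁, hv₂⟩, hv₃⟩, fun w hw =>
    ⟨hU₁ w hw.1.1, hU₂ w hw.1.2, hU₃ w hw.2⟩⟩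

/-- `S.Near v v`. [folklore] -/
theorem near_self (v : V) : S.Near v v :=
  ⟨fun _ _ h => h, fun _ _ _ => S.genPt_specializes v _, fun _ _ _ _ _ _ _ => S.genPt₂_specializes v _⟩

variable [Algebra V.functionField L]

/-- **In the good neighbourhood, charges are the charges at `v`**: for `S.Near v w`, a divisor is
charged at `w` iff it passes through `w` and is charged at `v`. [folklore] -/
theorem Near.chargedAt_iff (H : S.EndHyp) {v w : V} (hn : S.Near v w) (D : V.IdealSheafData) :
    S.chargedAt D w ↔ w ∈ D.support ∧ S.chargedAt D v := by
  constructor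
  · intro h
    have hDE : D ∈ S.E := S.mem_E_of_chargedAt h
    have hwD : w ∈ D.support := S.mem_support_of_chargedAt h
    have hvD : v ∈ D.support := hn.1 D hDE hwD
    exact ⟨hwD, (S.chargedAt_iff_of_specializes H D ⟨hDE, hvD⟩ ⟨hDE, hwD⟩ (hn.2.1 D ⟨hDE, hvD⟩ hwD)).mpr h⟩
  · rintro ⟨hwD, h⟩
    have hDE : D ∈ S.E := S.mem_E_of_chargedAt h
    have hvD : v ∈ D.support := S.mem_support_of_chargedAt h
    exact (S.chargedAt_iff_of_specializes H D ⟨hDE, hvD⟩ ⟨hDE, hwD⟩ (hn.2.1 D ⟨hDE, hvD⟩ hwD)).mp h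

/-- In the good neighbourhood of a non-toroidal point there are no toroidal points. [folklore] -/
theorem Near.not_mem_tor (H : S.EndHyp) {v w : V} (hn : S.Near v w) (hv : v ∉ S.tor) : w ∉ S.tor := by
  rintro ⟨D, hD⟩
  exact hv ⟨D, ((hn.chargedAt_iff S H D).mp hD).2⟩

end GameState

/-- The good neighbourhood of a point of an end state exists (explicit-binder form, the registered
interface of this helper file). [folklore] -/
theorem gameState_exists_nhds_near {p : ℕ} {V₀ : Scheme.{0}} [IsIntegral V₀] {L : Type} [Field L]
    [Algebra V₀.functionField L] {V : Scheme.{0}} [IsIntegral V] {π : V ⟶ V₀} [IsDominant π]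
    (S : GameState p V₀ L V π) (hN : IsLocallyNoetherian V) (v : V) :
    ∃ U : V.Opens, v ∈ U ∧ ∀ w ∈ U, S.Near v w :=
  S.exists_nhds_near hN v

end Summit.ResolutionOfSingularities.ResolutionOfSingularities.Theorems.RadicialJung.CleanModelsSuffice

end
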